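import Literature.AlgebraicGeometry.Resolution.TeissierPresentation
import Literature.AlgebraicGeometry.Resolution.TameQuotientSingularitiesResolution
import Literature.AlgebraicGeometry.Resolution.ArtinApproximation
import Literature.AlgebraicGeometry.Resolution.SurfaceResolutionReduction
import Summits.ResolutionOfSingularities.ResolutionOfSingularities.Theses.TeissierJung

/-!
# Sketch — crux idea `toric-normalisation-destackify` for `TeissierJung.TeissierResolve`
(stmt-ResolutionOfSingularities-17086), crux-ideate round 1, ideator 1.

First checkable statements of the line, typed over existing declarations (nothing is proved
here; the defs must elaborate).

* `ToricNormalization` — FIRST LEMMA (local algebra): the integral closure of a Teissier-presented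
  complete local domain `R = k⟦x⟧[u] ⧸ (E)` is ring-isomorphic to the degree-`0` part of a grading
  of the power-series ring `k⟦y₁..y_d⟧` by a finite abelian group `Λ` — i.e. to the completed
  simplicial toric ring `k⟦y⟧^{D(Λ)}` (`y = x^{1/N}`, `D(Λ)` the diagonalizable Cartier dual):
  "overweight tails are invisible to the normalisation".
* `NormalizationHasDiagonalizableCharts` — the TRANSFER `C⁺` at scheme level: the normalisation of
  a Teissier-presented `X'` is covered by étale charts `Spec S₀ → X'^ν` with `S` smooth of finite
  type graded by a finite abelian group (the hypothesis of the vendored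
  `BerghRydh2019_diagonalizableQuotientResolution`, verbatim).
* `LocalToCharts`, `LineShape` — the two implications the line consists of, as statements.
-/

noncomputable section

open CategoryTheory AlgebraicGeometry TopologicalSpace IsLocalRing
open Literature.AlgebraicGeometry.Resolution

namespace Summit.ResolutionOfSingularities.ResolutionOfSingularities.Cruxes.TeissierResolve.ToricNormalisation

/-- FIRST LEMMA (`toric-normalisation-destackify`). For a Teissier datum over an algebraically
closed field of characteristic `p` whose presented ring `R = k⟦x₁..x_d⟧[u₀..u_{g-1}] ⧸ (E₀..E_{g-1})`
is a domain, finite over `k⟦x⟧` (both hold for `R ≅ 𝒪̂_{X',x} ⧸ P` in the crux), the integral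
closure of `R` in its fraction field is isomorphic to the degree-zero part `𝒮 0` of a grading of
`k⟦y₁..y_d⟧` by a finite abelian group `Λ` (`= ((1/N)ℤ^d)/M`, `M` the group generated by the
standard basis and the weights `v_i`; `𝒮 0 = k⟦M ∩ ℚ^d_{≥0}⟧ = k⟦y⟧^{D(Λ)}`). Mechanism: the
`g` quotients `ρ_i = u_i^{n_i} / (c_i x^{A_i} u^{μ_i})` are `1`-units of the normalisation; the
exponent lattice of the binomials is saturated (⇔ `IsDatum.isPrime`), so a `g × g` minor is prime
to `p` and the multiplicative linear system `η_i^{n_i} = ε^{A_i} η^{μ_i} ρ_i` is solvable in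
`1`-units by Hensel (prime-to-`p` roots only); `x' = x/ε`, `u' = u/η` satisfy the binomials
exactly, and the normalisation of `k⟦x'⟧ ⊗ k[Γ]` is `k⟦x'⟧ ⊗ k[Γ^{sat}] = k⟦y⟧^{D}`. -/
def ToricNormalization : Prop :=
  ∀ (p : ℕ) [Fact p.Prime] (k : Type) [Field k] [CharP k p] [IsAlgClosed k] (d g : ℕ)
    (n : Fin g → ℕ) (v : Fin g → (Fin d → ℚ)) (c : Fin g → k) (A : Fin g → (Fin d →₀ ℕ))
    (mu : Fin g → (Fin g →₀ ℕ)) (h : Fin g → MvPolynomial (Fin g) (MvPowerSeries (Fin d) k)),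
    Teissier.IsDatum n v c A mu h →
    IsDomain (MvPolynomial (Fin g) (MvPowerSeries (Fin d) k) ⧸ Teissier.ideal n c A mu h) →
    Module.Finite (MvPowerSeries (Fin d) k)
      (MvPolynomial (Fin g) (MvPowerSeries (Fin d) k) ⧸ Teissier.ideal n c A mu h) →
    ∃ (Λ : Type) (_ : AddCommGroup Λ) (_ : Finite Λ) (_ : DecidableEq Λ)
      (𝒮 : Λ → Submodule k (MvPowerSeries (Fin d) k)) (_ : GradedAlgebra 𝒮),
      Nonempty
        (integralClosure (MvPolynomial (Fin g) (MvPowerSeries (Fin d) k) ⧸ Teissier.ideal n c A mu h)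
            (FractionRing (MvPolynomial (Fin g) (MvPowerSeries (Fin d) k) ⧸ Teissier.ideal n c A mu h))
          ≃+* 𝒮 0)

/-- TRANSFER `C⁺` (`toric-normalisation-destackify`): the normalisation of a Teissier-presented
scheme over an algebraically closed field of characteristic `p` has DIAGONALIZABLE QUOTIENT
SINGULARITIES in the sense of `BerghRydh2019_diagonalizableQuotientResolution` (verbatim chart
condition): every point of `X'^ν` lies in the image of an étale `k`-morphism `Spec S₀ → X'^ν`
with `S` a smooth finitely generated `k`-algebra graded by a finite abelian group. (From
`ToricNormalization` at closed points via Artin 1969 Cor. 2.6 — étale-local isomorphism from an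
isomorphism of complete local rings — and base change of the grading; non-closed points by
openness of étale images.) -/
def NormalizationHasDiagonalizableCharts : Prop :=
  ∀ (p : ℕ) [Fact p.Prime] (k : Type) [Field k] [CharP k p] [IsAlgClosed k]
    (X' : Scheme.{0}) [IsIntegral X'] (f : X' ⟶ Spec (.of k)) [LocallyOfFiniteType f]
    [QuasiCompact f] [IsSeparated f],
    TeissierPresented k X' →
    ∀ y : normalization X',
      ∃ (Λ : Type) (_ : AddCommGroup Λ) (_ : Finite Λ) (_ : DecidableEq Λ)
        (S : Type) (_ : CommRing S) (_ : Algebra k S) (𝒮 : Λ → Submodule k S)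
        (_ : GradedAlgebra 𝒮), Algebra.FiniteType k S ∧ Algebra.Smooth k S ∧
        ∃ φ : Spec (.of (𝒮 0)) ⟶ normalization X', Etale φ ∧ y ∈ Set.range φ ∧
          φ ≫ normalizationι X' ≫ f = Spec.map (CommRingCat.ofHom (algebraMap k (𝒮 0)))

/-- The local-to-chart step of the line, as a statement: toric normalisation of the branches plus
Artin approximation (étale-neighbourhood form) give the diagonalizable charts. -/
def LocalToCharts : Prop :=
  ToricNormalization → Artin1969EtaleApproximation.{0} → NormalizationHasDiagonalizableCharts

/-- The shape of the whole line: `C⁺` and the vendored Bergh–Rydh theorem give the crux BY NAME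
(through `Scheme.HasResolution.of_normalization`, in tree). -/
def LineShape : Prop :=
  NormalizationHasDiagonalizableCharts → BerghRydh2019_diagonalizableQuotientResolution →
    Summit.ResolutionOfSingularities.ResolutionOfSingularities.Theses.TeissierJung.TeissierResolve

end Summit.ResolutionOfSingularities.ResolutionOfSingularities.Cruxes.TeissierResolve.ToricNormalisation

end
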